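import Summits.BirchSwinnertonDyer.BirchSwinnertonDyer.Theorems.KimAtThreeShallowEqDeepAnomalousRider
import HarnessLib

/-!
# Route `KimAtThreeKolyvagin` (W2): GeneralLevel ★★ / ★ with the TWISTED (P-EXP) rider — DICT3's value clause
# `Λfin(loc_v κ_r) = u·p⁰·δ̃` for an arbitrary THEOREM-D output of Kato's Euler system (the Kato–Kurihara port on
# the good ANOMALOUS rows at `3`, rider side, file 2)

Cell `bsd-addord`, seat `bsd-addord-w2-c4` (gen 9; owner of crux 19599 `ShallowEqDeepOffKatoStratum`, item
19077 `ShallowEqDeepAtTorsionFree`).  `--supports` 19599.  HONEST FRAMING: TOOL THEOREMS ONLY (no definition,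
no named fact, no instance, no `sorry`); Kato's `ZetaBody` and the TWISTED rider clause (ii_τ) enter as DISPLAYED
HYPOTHESES (`hbody`, `hfinτ`), never asserted; nothing is booked; 19599 / 19077 / 19560 stay OPEN; BSD is not
proved by any of this.  Credit: n1011-p13's `KatoValue.GeneralLevel.apply_localization_add_self_eq_toZModPow_of_derivativeFamily`
and `exists_unit_apply_localization_eq_of_derivativeFamily` (PK-6 general) — this file is those two theorems with
`hfin ↦ hfinτ` (the twisted clause, see the companion `KimAtThreeShallowEqDeepAnomalousRider` for its text and
STATUS) and the premise / unit reading on the twisted lattice; (S1), (S2), the pin glue and the commutation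
witness BY NAME as there.  HONEST LIMITS: closes nothing; books nothing; 0 defs / 0 facts.

References: K. Kato, Astérisque 295 (2004) §9.4, Thm. 9.7 [Kato2004Asterisque]; C.-H. Kim, AJM 148 (2026) =
arXiv:2203.12159, §3.4.1 and the proof of Thm. 3.13 [Kim2022StructureSelmer]; B. Mazur, K. Rubin, Mem. AMS
799 (2004) Thm. 3.2.4, App. A [MazurRubin2004]; K. Rubin, *Euler Systems* (2000) Def. 4.4.4 [Rubin2000].
-/

noncomputable section

-- the Theorems namespace of a single-conjunct summit repeats the summit name by design (D-0017)
set_option linter.dupNamespace false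

open scoped NumberField TensorProduct
open CategoryTheory Field Finset IsDedekindDomain NumberField WeierstrassCurve Rat.HeightOneSpectrum
open Literature.NumberTheory.GaloisRepresentations Literature.NumberTheory.GaloisCohomology
open Literature.NumberTheory.GaloisRepresentations.DiscreteGaloisModule
open Literature.NumberTheory.EllipticCurves Literature.NumberTheory.EllipticCurves.Kato2004
open Literature.NumberTheory.EllipticCurves.Kato2004.EulerSystemValues
open Summit.BirchSwinnertonDyer.Rank1Residual.GaloisImage
open Summit.BirchSwinnertonDyer.Rank1Residual.GaloisImage.KatoValue
open Summit.BirchSwinnertonDyer.Rank1Residual.GaloisImage.KatoValue.GeneralLevel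
open Summit.BirchSwinnertonDyer.BirchSwinnertonDyer.Theorems.KimAtThreeShallowEqDeepAnomalousRider

namespace Summit.BirchSwinnertonDyer.BirchSwinnertonDyer.Theorems.KimAtThreeShallowEqDeepAnomalousRiderGeneralLevel

/-! ### §2 GeneralLevel ★★ / ★ with the twisted rider (THEOREM D's literal currency) -/

section General

variable (W : WeierstrassCurve ℚ) [W.IsElliptic] (p : ℕ) [Fact p.Prime]
  [ContinuousSMul ℤ_[p] (W.tateModule p)] [Module.Free ℤ_[p] (W.tateModule p)]
  [Module.Finite ℤ_[p] (W.tateModule p)] {N : ℕ} (f : CuspForm (CongruenceSubgroup.Gamma0 N) 2)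
  (ι : (m : ℕ) → (CyclotomicField m ℚ →+* ℂ)) (κK : ℝ)
  (Λ : ∀ (k' : ℕ) (r : Finset (HeightOneSpectrum (𝓞 ℚ))),
    H1 (tateRep W p) (cycSubgroup p k' r) →ₗ[ℤ_[p]] ℚ_[p] ⊗[ℚ] CyclotomicField (cycLevel p k' r) ℚ)
  (c d a : ℤ) (A : ℕ)
  (z : ∀ (k' : ℕ) (r : (cyclotomicLevelsRat p (badPlaces c d A N)).Ideals),
    H1 (tateRep W p) ((cyclotomicLevelsRat p (badPlaces c d A N)).level k' r.1))
  (x : ∀ (k' : ℕ) (r : (cyclotomicLevelsRat p (badPlaces c d A N)).Ideals),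
    CyclotomicField (cycLevel p k' r.1) ℚ)

/-- Local notation: `𝓛` = the levels of Kato's Euler system for the auxiliary datum `(c, d, A)`. -/
local notation3 "𝓛" => cyclotomicLevelsRat p (badPlaces c d A N)

/-- Local notation: `𝐃⟦X, U, τ⟧ ℓ = ∑_{j < ℓ−1} j·(τ_ℓ)_*^j` on `H¹(U, X)` (THEOREM D's `ℤ`-spelling). -/
local notation3 (prettyPrint := false) "𝐃⟦" X ", " U ", " τ "⟧" =>
  fun ℓ : HeightOneSpectrum (𝓞 ℚ) =>
  ∑ j ∈ Finset.range (((primesEquiv ℓ : Nat.Primes) : ℕ) - 1),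
    (j : Module.End ℤ (continuousCohomology 1 (subgroupRep X U))) *
      (conjMap X U ((τ : HeightOneSpectrum (𝓞 ℚ) → absoluteGaloisGroup ℚ) ℓ) 1).hom.toLinearMap ^ j

/-- Local notation: `𝐃F⟦r, τ⟧ ℓ` = the same operator on the level FIELD `ℚ(ζ_{m(0,r)})`. -/
local notation3 (prettyPrint := false) "𝐃F⟦" r ", " τ "⟧" =>
  fun ℓ : HeightOneSpectrum (𝓞 ℚ) =>
  ∑ j ∈ Finset.range (((primesEquiv ℓ : Nat.Primes) : ℕ) - 1),
    (j : Module.End ℚ (CyclotomicField (cycLevel p 0 r) ℚ)) *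
      (sigma (cycLevel p 0 r) (modNCyclotomicCharacter ℚ (cycLevel p 0 r)
          ((τ : HeightOneSpectrum (𝓞 ℚ) → absoluteGaloisGroup ℚ) ℓ)) :
        CyclotomicField (cycLevel p 0 r) ℚ →ₐ[ℚ] CyclotomicField (cycLevel p 0 r) ℚ).toLinearMap ^ j

set_option backward.isDefEq.respectTransparency false in
/-- **★★ THE GENERAL-LEVEL VALUE LAW with the TWISTED rider, THEOREM D's LITERAL CURRENCY** (n1011-p13's
GeneralLevel ★★ with `hfin` ↦ `hfinτ` and the twisted premise): IF
`p • (1 ⊗ D^{field}_r (x_{0,r} + σ₋₁ x_{0,r})) − (s·(p − a_p + 1)) ⊗ 1 ∈ p^{k+1} • (1 ⊗ P_w)·L_int` THEN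
`Λfin (loc_v (κ_r + κ_r)) = s mod p^{k+1}`.  (S1) + (S2) + pin glue + §1b, the conjugation with `χ = −1` inside.
[cite: Kato2004Asterisque, §9.4 (p. 188) and Thm. 9.7 (p. 189)]
[cite: Kim2022StructureSelmer, §3.4.1 and the proof of Thm. 3.13 (arXiv v3 pp. 26–27; = Thm. 3.11 of AJM 148)]
[cite: MazurRubin2004, Thm. 3.2.4 and App. A] [cite: Rubin2000, Def. 4.4.4] -/
theorem apply_localization_add_self_eq_toZModPow_of_derivativeFamily_twist
    (hbody : ZetaBody W p f ι κK Λ c d a A z x)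
    {k : ℕ} {v : HeightOneSpectrum (𝓞 ℚ)}
    {Λfin : galoisCohomology ((W.torsionGaloisModule ((p : ℤ) ^ k * (p : ℤ))).toLocal
      (Sum.inr v)) 1 →+ ZMod (p ^ (k + 1))} (ap : ℤ)
    -- the ANOMALOUS rider's scalar clause (ii_τ): the premise is stated on the TWISTED lattice `(1 ⊗ P_w)·L_int`,
    -- `P_w = p − a_pδ_w + δ_{w²}`, `w·[p] = 1`, with the scalar `s·(p − a_p + 1) = s·#Ẽ(𝔽_p)`
    (hfinτ : ∀ (r : Finset (HeightOneSpectrum (𝓞 ℚ))) (w : (ZMod (cycLevel p 0 r))ˣ),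
      (w : ZMod (cycLevel p 0 r)) * (p : ZMod (cycLevel p 0 r)) = 1 →
      ∀ (Ψ : H1 (tateRep W p) (cycSubgroup p 0 r) →+
          continuousCohomology 1
            (subgroupRep (W.torsionGaloisModule ((p : ℤ) ^ k * (p : ℤ))).toTopRep (cycSubgroup p 0 r))),
        (∀ (φ : contOneCocycles (subgroupRep (tateRep W p).toTopRep (cycSubgroup p 0 r)))
            (ψ : contOneCocycles
              (subgroupRep (W.torsionGaloisModule ((p : ℤ) ^ k * (p : ℤ))).toTopRep (cycSubgroup p 0 r))),
            (∀ g, ((ψ.1 g : geomTorsion W ((p : ℤ) ^ k * (p : ℤ))) : geomPoints W) =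
              TateModule.proj p (k + 1) (φ.1 g)) →
            Ψ (oneCocycleClass _ φ) = oneCocycleClass _ ψ) →
        ∀ (y : H1 (tateRep W p) (cycSubgroup p 0 r))
          (κ₀ : galoisCohomology (W.torsionGaloisModule ((p : ℤ) ^ k * (p : ℤ))) 1) (s : ℤ_[p]),
          resSubgroup (W.torsionGaloisModule ((p : ℤ) ^ k * (p : ℤ))).toTopRep (cycSubgroup p 0 r) 1 κ₀ =
              Ψ y →
          galoisCohomology.localization (W.torsionGaloisModule ((p : ℤ) ^ k * (p : ℤ))) (Sum.inr v) 1 κ₀ ∈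
              propagatedSelmerStructure W p k (Sum.inr v) →
          (∃ l ∈ cycIntLattice p (cycLevel p 0 r),
              (p : ℤ_[p]) • Λ 0 r y -
                  (((s * ((p : ℤ_[p]) - (ap : ℤ_[p]) + 1) : ℤ_[p]) : ℚ_[p]) ⊗ₜ[ℚ]
                    (1 : CyclotomicField (cycLevel p 0 r) ℚ)) =
                ((p : ℤ_[p]) ^ (k + 1)) • ∑ g : (ZMod (cycLevel p 0 r))ˣ,
                  (((((p : MonoidAlgebra ℤ_[p] (ZMod (cycLevel p 0 r))ˣ)) -
                      MonoidAlgebra.single w (ap : ℤ_[p]) +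
                      MonoidAlgebra.single (w ^ 2) (1 : ℤ_[p])).coeff g : ℤ_[p]) : ℚ_[p]) •
                    Algebra.TensorProduct.map (AlgHom.id ℚ ℚ_[p])
                      (sigma (cycLevel p 0 r) g : CyclotomicField (cycLevel p 0 r) ℚ →ₐ[ℚ]
                        CyclotomicField (cycLevel p 0 r) ℚ) l) →
          Λfin (galoisCohomology.localization (W.torsionGaloisModule ((p : ℤ) ^ k * (p : ℤ)))
              (Sum.inr v) 1 κ₀) = PadicInt.toZModPow (k + 1) s)
    {M' : Type} [AddCommGroup M'] [Module ℤ_[p] M'] [TopologicalSpace M'] [IsTopologicalAddGroup M']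
    [ContinuousSMul ℤ_[p] M'] {T' : GaloisRep ℚ ℤ_[p] M'}
    (red : (tateRep W p).toTopRep ⟶ T'.toTopRep)
    (e : M' →+ geomTorsion W ((p : ℤ) ^ k * (p : ℤ))) (hec : Continuous e)
    (he : ∀ (g : absoluteGaloisGroup ℚ) (y : M'),
      e (T'.toTopRep.ρ g y) = (W.torsionGaloisModule ((p : ℤ) ^ k * (p : ℤ))).toTopRep.ρ g (e y))
    (hpin : ∀ b : W.tateModule p,
      ((e (red.hom b) : geomTorsion W ((p : ℤ) ^ k * (p : ℤ))) : geomPoints W) =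
        TateModule.proj p (k + 1) b)
    (D : KolyvaginDatum (W.torsionGaloisModule ((p : ℤ) ^ k * (p : ℤ))))
    (hPr : D.primes ⊆ (𝓛).primes)
    (σ : HeightOneSpectrum (𝓞 ℚ) → absoluteGaloisGroup ℚ)
    (Φ : ∀ r : Finset (HeightOneSpectrum (𝓞 ℚ)),
      continuousCohomology 1 (subgroupRep T'.toTopRep ((𝓛).level ⊥ r)) →+
        continuousCohomology 1 (subgroupRep
          (W.torsionGaloisModule ((p : ℤ) ^ k * (p : ℤ))).toTopRep ((𝓛).level ⊥ r)))
    (comm : ∀ r : Finset (HeightOneSpectrum (𝓞 ℚ)),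
      ((r : Finset _) : Set (HeightOneSpectrum (𝓞 ℚ))).Pairwise fun a' b' =>
        Commute (𝐃⟦(W.torsionGaloisModule ((p : ℤ) ^ k * (p : ℤ))).toTopRep, ((𝓛).level ⊥ r), σ⟧ a')
          (𝐃⟦(W.torsionGaloisModule ((p : ℤ) ^ k * (p : ℤ))).toTopRep, ((𝓛).level ⊥ r), σ⟧ b'))
    (κ : Finset (HeightOneSpectrum (𝓞 ℚ)) →
      galoisCohomology (W.torsionGaloisModule ((p : ℤ) ^ k * (p : ℤ))) 1)
    (hΦ : ∀ r, ∀ (φ : contOneCocycles (subgroupRep T'.toTopRep ((𝓛).level ⊥ r)))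
      (ψ : contOneCocycles (subgroupRep
        (W.torsionGaloisModule ((p : ℤ) ^ k * (p : ℤ))).toTopRep ((𝓛).level ⊥ r))),
      (∀ g, ψ.1 g = e (φ.1 g)) → Φ r (oneCocycleClass _ φ) = oneCocycleClass _ ψ)
    (hKS : D.IsKolyvaginSystem (propagatedSelmerStructure W p k) κ)
    (hres : ∀ (r : Finset (HeightOneSpectrum (𝓞 ℚ))) (hr : (↑r : Set _) ⊆ D.primes),
      resSubgroup (W.torsionGaloisModule ((p : ℤ) ^ k * (p : ℤ))).toTopRep ((𝓛).level ⊥ r) 1 (κ r) =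
        (r.noncommProd 𝐃⟦(W.torsionGaloisModule ((p : ℤ) ^ k * (p : ℤ))).toTopRep,
            ((𝓛).level ⊥ r), σ⟧ (comm r))
          (Φ r (ContinuousCohomology.map (ContinuousMonoidHom.id _)
            (X := subgroupRep (tateRep W p).toTopRep ((𝓛).level ⊥ r))
            (Y := subgroupRep T'.toTopRep ((𝓛).level ⊥ r))
            ((TopRep.resFunctor ((𝓛).level ⊥ r).subtype).map red) 1
            (z ⊥ ⟨r, fun _ hq => hPr (hr (Finset.mem_coe.2 hq))⟩))))
    (hvp : ((primesEquiv v : Nat.Primes) : ℕ) = p)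
    (r : Finset (HeightOneSpectrum (𝓞 ℚ))) (hr : (↑r : Set _) ⊆ D.primes)
    (w : (ZMod (cycLevel p 0 r))ˣ) (hw₁ : (w : ZMod (cycLevel p 0 r)) * (p : ZMod (cycLevel p 0 r)) = 1)
    (s : ℤ_[p])
    (hval : ∃ l ∈ cycIntLattice p (cycLevel p 0 r),
      (p : ℤ_[p]) • ((1 : ℚ_[p]) ⊗ₜ[ℚ]
        ((r.noncommProd 𝐃F⟦r, σ⟧ (ZetaValue.pairwise_commute_fieldDeriv (cycLevel p 0 r)
            (fun ℓ => modNCyclotomicCharacter ℚ (cycLevel p 0 r) (σ ℓ))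
            (fun ℓ => ((primesEquiv ℓ : Nat.Primes) : ℕ) - 1) r))
          (x 0 ⟨r, fun _ hq => hPr (hr (Finset.mem_coe.2 hq))⟩ +
            sigma (cycLevel p 0 r) (-1) (x 0 ⟨r, fun _ hq => hPr (hr (Finset.mem_coe.2 hq))⟩)))) -
          (((s * ((p : ℤ_[p]) - (ap : ℤ_[p]) + 1) : ℤ_[p]) : ℚ_[p]) ⊗ₜ[ℚ]
            (1 : CyclotomicField (cycLevel p 0 r) ℚ)) =
        ((p : ℤ_[p]) ^ (k + 1)) • ∑ g : (ZMod (cycLevel p 0 r))ˣ,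
          (((((p : MonoidAlgebra ℤ_[p] (ZMod (cycLevel p 0 r))ˣ)) -
              MonoidAlgebra.single w (ap : ℤ_[p]) +
              MonoidAlgebra.single (w ^ 2) (1 : ℤ_[p])).coeff g : ℤ_[p]) : ℚ_[p]) •
            Algebra.TensorProduct.map (AlgHom.id ℚ ℚ_[p])
              (sigma (cycLevel p 0 r) g : CyclotomicField (cycLevel p 0 r) ℚ →ₐ[ℚ]
                CyclotomicField (cycLevel p 0 r) ℚ) l) :
    Λfin (galoisCohomology.localization (W.torsionGaloisModule ((p : ℤ) ^ k * (p : ℤ)))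
        (Sum.inr v) 1 (κ r + κ r)) = PadicInt.toZModPow (k + 1) s := by
  -- usable primes are `≠ p`, so `v ∉ r`; clause (0) at `v` by (S2)
  have hvr : v ∉ r := fun hmem => (hPr (hr (Finset.mem_coe.2 hmem))).2 hvp
  have hloc := localization_mem_of_isKolyvaginSystem hKS hr hvr
  -- a conjugation of the level: `χ_{m(0,r)}(g) = −1` (no datum, no hypothesis)
  obtain ⟨g, hg⟩ := KatoParity.exists_modNCyclotomicCharacter_eq_neg_one (cycLevel p 0 r)
  -- `Ψ_r := Φ_r ∘ red_*`, admissible by the pin glue; `res κ_r = Ψ_r (D^T_r z_{0,r})` by (S1)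
  let Ψ : H1 (tateRep W p) (cycSubgroup p 0 r) →+
      continuousCohomology 1
        (subgroupRep (W.torsionGaloisModule ((p : ℤ) ^ k * (p : ℤ))).toTopRep (cycSubgroup p 0 r)) :=
    (Φ r).comp (ContinuousCohomology.map (ContinuousMonoidHom.id (cycSubgroup p 0 r))
        (X := subgroupRep (tateRep W p).toTopRep (cycSubgroup p 0 r))
        (Y := subgroupRep T'.toTopRep (cycSubgroup p 0 r))
        ((TopRep.resFunctor (cycSubgroup p 0 r).subtype).map red) 1).hom.toLinearMap.toAddMonoidHom
  exact apply_localization_add_self_eq_toZModPow_of_zetaBody_deriv_twist hbody ap hfinτ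
    ⟨r, fun _ hq => hPr (hr (Finset.mem_coe.2 hq))⟩ w hw₁ Ψ
    (fun φ ψ h => comp_oneCocycleClass_eq_of_pin red e hpin (cycSubgroup p 0 r) (Φ r) (hΦ r) φ ψ h)
    σ (fun ℓ => ((primesEquiv ℓ : Nat.Primes) : ℕ) - 1) r
    (pairwise_commute_tateDeriv W p r σ (fun ℓ => ((primesEquiv ℓ : Nat.Primes) : ℕ) - 1) r) hg (κ r) s
    (resSubgroup_eq_comp_map_deriv red e hec he (cycSubgroup p 0 r) (Φ r) (hΦ r) σ
      (fun ℓ => ((primesEquiv ℓ : Nat.Primes) : ℕ) - 1) r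
      (pairwise_commute_tateDeriv W p r σ (fun ℓ => ((primesEquiv ℓ : Nat.Primes) : ℕ) - 1) r)
      (comm r) _ (κ r) (hres r hr))
    hloc hval

/-- **★ DICT3's VALUE CLAUSE at the level `r` for THEOREM D's OWN class `κ_r`, twisted rider** (`p` odd):
from ★★ and the unit reading `s̄ = w·p⁰·δ̃`, halving: `∃ u, Λfin (loc_v κ_r) = u · p⁰ · δ̃`.
[cite: Kim2022StructureSelmer, §3.4.1 and the proof of Thm. 3.13 (arXiv v3 pp. 26–27; = Thm. 3.11 of AJM 148)]
[cite: Kato2004Asterisque, Thm. 9.7 (p. 189)] -/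
theorem exists_unit_apply_localization_eq_of_derivativeFamily_twist (hp2 : p ≠ 2)
    (hbody : ZetaBody W p f ι κK Λ c d a A z x)
    {k : ℕ} {v : HeightOneSpectrum (𝓞 ℚ)}
    {Λfin : galoisCohomology ((W.torsionGaloisModule ((p : ℤ) ^ k * (p : ℤ))).toLocal
      (Sum.inr v)) 1 →+ ZMod (p ^ (k + 1))} (ap : ℤ)
    -- the ANOMALOUS rider's scalar clause (ii_τ): the premise is stated on the TWISTED lattice `(1 ⊗ P_w)·L_int`,
    -- `P_w = p − a_pδ_w + δ_{w²}`, `w·[p] = 1`, with the scalar `s·(p − a_p + 1) = s·#Ẽ(𝔽_p)`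
    (hfinτ : ∀ (r : Finset (HeightOneSpectrum (𝓞 ℚ))) (w : (ZMod (cycLevel p 0 r))ˣ),
      (w : ZMod (cycLevel p 0 r)) * (p : ZMod (cycLevel p 0 r)) = 1 →
      ∀ (Ψ : H1 (tateRep W p) (cycSubgroup p 0 r) →+
          continuousCohomology 1
            (subgroupRep (W.torsionGaloisModule ((p : ℤ) ^ k * (p : ℤ))).toTopRep (cycSubgroup p 0 r))),
        (∀ (φ : contOneCocycles (subgroupRep (tateRep W p).toTopRep (cycSubgroup p 0 r)))
            (ψ : contOneCocycles
              (subgroupRep (W.torsionGaloisModule ((p : ℤ) ^ k * (p : ℤ))).toTopRep (cycSubgroup p 0 r))),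
            (∀ g, ((ψ.1 g : geomTorsion W ((p : ℤ) ^ k * (p : ℤ))) : geomPoints W) =
              TateModule.proj p (k + 1) (φ.1 g)) →
            Ψ (oneCocycleClass _ φ) = oneCocycleClass _ ψ) →
        ∀ (y : H1 (tateRep W p) (cycSubgroup p 0 r))
          (κ₀ : galoisCohomology (W.torsionGaloisModule ((p : ℤ) ^ k * (p : ℤ))) 1) (s : ℤ_[p]),
          resSubgroup (W.torsionGaloisModule ((p : ℤ) ^ k * (p : ℤ))).toTopRep (cycSubgroup p 0 r) 1 κ₀ =
              Ψ y →
          galoisCohomology.localization (W.torsionGaloisModule ((p : ℤ) ^ k * (p : ℤ))) (Sum.inr v) 1 κ₀ ∈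
              propagatedSelmerStructure W p k (Sum.inr v) →
          (∃ l ∈ cycIntLattice p (cycLevel p 0 r),
              (p : ℤ_[p]) • Λ 0 r y -
                  (((s * ((p : ℤ_[p]) - (ap : ℤ_[p]) + 1) : ℤ_[p]) : ℚ_[p]) ⊗ₜ[ℚ]
                    (1 : CyclotomicField (cycLevel p 0 r) ℚ)) =
                ((p : ℤ_[p]) ^ (k + 1)) • ∑ g : (ZMod (cycLevel p 0 r))ˣ,
                  (((((p : MonoidAlgebra ℤ_[p] (ZMod (cycLevel p 0 r))ˣ)) -
                      MonoidAlgebra.single w (ap : ℤ_[p]) +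
                      MonoidAlgebra.single (w ^ 2) (1 : ℤ_[p])).coeff g : ℤ_[p]) : ℚ_[p]) •
                    Algebra.TensorProduct.map (AlgHom.id ℚ ℚ_[p])
                      (sigma (cycLevel p 0 r) g : CyclotomicField (cycLevel p 0 r) ℚ →ₐ[ℚ]
                        CyclotomicField (cycLevel p 0 r) ℚ) l) →
          Λfin (galoisCohomology.localization (W.torsionGaloisModule ((p : ℤ) ^ k * (p : ℤ)))
              (Sum.inr v) 1 κ₀) = PadicInt.toZModPow (k + 1) s)
    {M' : Type} [AddCommGroup M'] [Module ℤ_[p] M'] [TopologicalSpace M'] [IsTopologicalAddGroup M']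
    [ContinuousSMul ℤ_[p] M'] {T' : GaloisRep ℚ ℤ_[p] M'}
    (red : (tateRep W p).toTopRep ⟶ T'.toTopRep)
    (e : M' →+ geomTorsion W ((p : ℤ) ^ k * (p : ℤ))) (hec : Continuous e)
    (he : ∀ (g : absoluteGaloisGroup ℚ) (y : M'),
      e (T'.toTopRep.ρ g y) = (W.torsionGaloisModule ((p : ℤ) ^ k * (p : ℤ))).toTopRep.ρ g (e y))
    (hpin : ∀ b : W.tateModule p,
      ((e (red.hom b) : geomTorsion W ((p : ℤ) ^ k * (p : ℤ))) : geomPoints W) =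
        TateModule.proj p (k + 1) b)
    (D : KolyvaginDatum (W.torsionGaloisModule ((p : ℤ) ^ k * (p : ℤ))))
    (hPr : D.primes ⊆ (𝓛).primes)
    (σ : HeightOneSpectrum (𝓞 ℚ) → absoluteGaloisGroup ℚ)
    (Φ : ∀ r : Finset (HeightOneSpectrum (𝓞 ℚ)),
      continuousCohomology 1 (subgroupRep T'.toTopRep ((𝓛).level ⊥ r)) →+
        continuousCohomology 1 (subgroupRep
          (W.torsionGaloisModule ((p : ℤ) ^ k * (p : ℤ))).toTopRep ((𝓛).level ⊥ r)))
    (comm : ∀ r : Finset (HeightOneSpectrum (𝓞 ℚ)),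
      ((r : Finset _) : Set (HeightOneSpectrum (𝓞 ℚ))).Pairwise fun a' b' =>
        Commute (𝐃⟦(W.torsionGaloisModule ((p : ℤ) ^ k * (p : ℤ))).toTopRep, ((𝓛).level ⊥ r), σ⟧ a')
          (𝐃⟦(W.torsionGaloisModule ((p : ℤ) ^ k * (p : ℤ))).toTopRep, ((𝓛).level ⊥ r), σ⟧ b'))
    (κ : Finset (HeightOneSpectrum (𝓞 ℚ)) →
      galoisCohomology (W.torsionGaloisModule ((p : ℤ) ^ k * (p : ℤ))) 1)
    (hΦ : ∀ r, ∀ (φ : contOneCocycles (subgroupRep T'.toTopRep ((𝓛).level ⊥ r)))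
      (ψ : contOneCocycles (subgroupRep
        (W.torsionGaloisModule ((p : ℤ) ^ k * (p : ℤ))).toTopRep ((𝓛).level ⊥ r))),
      (∀ g, ψ.1 g = e (φ.1 g)) → Φ r (oneCocycleClass _ φ) = oneCocycleClass _ ψ)
    (hKS : D.IsKolyvaginSystem (propagatedSelmerStructure W p k) κ)
    (hres : ∀ (r : Finset (HeightOneSpectrum (𝓞 ℚ))) (hr : (↑r : Set _) ⊆ D.primes),
      resSubgroup (W.torsionGaloisModule ((p : ℤ) ^ k * (p : ℤ))).toTopRep ((𝓛).level ⊥ r) 1 (κ r) =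
        (r.noncommProd 𝐃⟦(W.torsionGaloisModule ((p : ℤ) ^ k * (p : ℤ))).toTopRep,
            ((𝓛).level ⊥ r), σ⟧ (comm r))
          (Φ r (ContinuousCohomology.map (ContinuousMonoidHom.id _)
            (X := subgroupRep (tateRep W p).toTopRep ((𝓛).level ⊥ r))
            (Y := subgroupRep T'.toTopRep ((𝓛).level ⊥ r))
            ((TopRep.resFunctor ((𝓛).level ⊥ r).subtype).map red) 1
            (z ⊥ ⟨r, fun _ hq => hPr (hr (Finset.mem_coe.2 hq))⟩))))
    (hvp : ((primesEquiv v : Nat.Primes) : ℕ) = p)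
    (r : Finset (HeightOneSpectrum (𝓞 ℚ))) (hr : (↑r : Set _) ⊆ D.primes)
    (w : (ZMod (cycLevel p 0 r))ˣ) (hw₁ : (w : ZMod (cycLevel p 0 r)) * (p : ZMod (cycLevel p 0 r)) = 1)
    (s : ℤ_[p])
    (hval : ∃ l ∈ cycIntLattice p (cycLevel p 0 r),
      (p : ℤ_[p]) • ((1 : ℚ_[p]) ⊗ₜ[ℚ]
        ((r.noncommProd 𝐃F⟦r, σ⟧ (ZetaValue.pairwise_commute_fieldDeriv (cycLevel p 0 r)
            (fun ℓ => modNCyclotomicCharacter ℚ (cycLevel p 0 r) (σ ℓ))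
            (fun ℓ => ((primesEquiv ℓ : Nat.Primes) : ℕ) - 1) r))
          (x 0 ⟨r, fun _ hq => hPr (hr (Finset.mem_coe.2 hq))⟩ +
            sigma (cycLevel p 0 r) (-1) (x 0 ⟨r, fun _ hq => hPr (hr (Finset.mem_coe.2 hq))⟩)))) -
          (((s * ((p : ℤ_[p]) - (ap : ℤ_[p]) + 1) : ℤ_[p]) : ℚ_[p]) ⊗ₜ[ℚ]
            (1 : CyclotomicField (cycLevel p 0 r) ℚ)) =
        ((p : ℤ_[p]) ^ (k + 1)) • ∑ g : (ZMod (cycLevel p 0 r))ˣ,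
          (((((p : MonoidAlgebra ℤ_[p] (ZMod (cycLevel p 0 r))ˣ)) -
              MonoidAlgebra.single w (ap : ℤ_[p]) +
              MonoidAlgebra.single (w ^ 2) (1 : ℤ_[p])).coeff g : ℤ_[p]) : ℚ_[p]) •
            Algebra.TensorProduct.map (AlgHom.id ℚ ℚ_[p])
              (sigma (cycLevel p 0 r) g : CyclotomicField (cycLevel p 0 r) ℚ →ₐ[ℚ]
                CyclotomicField (cycLevel p 0 r) ℚ) l)
    {δ : ZMod (p ^ (k + 1))} (wu : (ZMod (p ^ (k + 1)))ˣ)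
    (hw : PadicInt.toZModPow (k + 1) s =
      (wu : ZMod (p ^ (k + 1))) * (p : ZMod (p ^ (k + 1))) ^ (0 : ℕ) * δ) :
    ∃ u : (ZMod (p ^ (k + 1)))ˣ,
      Λfin (galoisCohomology.localization (W.torsionGaloisModule ((p : ℤ) ^ k * (p : ℤ)))
          (Sum.inr v) 1 (κ r)) = (u : ZMod (p ^ (k + 1))) * (p : ZMod (p ^ (k + 1))) ^ (0 : ℕ) * δ := by
  have h2 := apply_localization_add_self_eq_toZModPow_of_derivativeFamily_twist W p f ι κK Λ c d a A z x
    hbody ap hfinτ red e hec he hpin D hPr σ Φ comm κ hΦ hKS hres hvp r hr w hw₁ s hval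
  rw [hw, map_add, map_add, ← two_mul] at h2
  refine ⟨(KatoParity.isUnit_two_zmod_pow hp2 k).unit⁻¹ * wu, ?_⟩
  rw [Units.val_mul, mul_assoc, mul_assoc, ← mul_assoc (wu : ZMod (p ^ (k + 1))), ← h2, ← mul_assoc,
    IsUnit.val_inv_mul, one_mul]

end General

end Summit.BirchSwinnertonDyer.BirchSwinnertonDyer.Theorems.KimAtThreeShallowEqDeepAnomalousRiderGeneralLevel

end
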